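import Summits.MatrixMultiplication.OmegaCensus.SmallFormats.MatMul22nRankGF7Slack6Search
import HarnessLib

/-!
# ω-census family (a): the slack-6 search checker — piecewise forms of CHECK B and of the MAIN CHECK (kernel memory bound)

Cell `pub-omega` (unit `pub-omega-tensor-g18`), topic `Summits/MatrixMultiplication/OmegaCensus` (sub-folder `SmallFormats`).
Framing (verbatim): lottery ticket; floor = certified bounds/negative ranges. HONEST FRAMING: kernel bookkeeping only
(`pub-omega-tensor-g18/KERNEL-S6-SPLIT.md`). The replay of `searchT6 c` (`MatMul22nRankGF7Slack6Search`) for the largest classes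
(up to 10 661 search nodes) and of `mainOK6 h` exceeds the kernel's memory cap in one declaration (measured: 3 904 nodes pass, 7 300 do not),
so the certificate is replayed in PIECES, each its own declaration: `searchT6p c a b` (listed level-1 children `a ≤ t < b` of class `c` die),
`searchT6f c a` (children `t ≥ a` die), glued by `searchT6p_append` / `searchT6_of_pf` into `SearchT6 c` (the two arms of `searchT6 c`
applied to the level-1 entry range `range1_6 c`, see the note below); and `mainOK6p h c₀ n`
(lanes `c₀ … c₀+n−1` of the total plane of element `h`), glued by `lanesOK6_of_piece` / `lanesOK6_append` into `LanesOK6 h 0 3692`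
(every lane passes `laneOK6`, which is all the soundness proof `MatMul22nRankGF7Slack6SearchSound` uses of `mainOK6`).
Nothing here is progress on `ω`.
-/

namespace Summit.MatrixMultiplication.OmegaCensus.SmallFormats

/-! ## CHECK B (table part of level 1) in pieces

The level-1 entry range of class `c` is `range1_6 c = lookup6 1 (needKey6 1 (repW6 c))`. All checks are written as functions of an
ABSTRACT range `r : Option (ℕ × ℕ)` (definitions by pattern matching on `r`) and only then applied to `range1_6 c`: a `match` on the
concrete discriminant `lookup6 1 (needKey6 1 (repW6 c))` with symbolic `c` must never be unfolded in a proof (the kernel then tries to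
evaluate the discriminant and unfolds `Nat.mul _ <26 kbit literal>` by recursion — measured: `excessive memory`), which is also why the
replay does not use the landed `searchT6` but the extensionally equal `SearchT6 c := fullOK6 c (range1_6 c) = true`. -/

/-- The level-1 entry range `[s, e)` of class `c` (or `none` if its need key is not a table key). -/
def range1_6 (c : ℕ) : Option (ℕ × ℕ) := lookup6 1 (needKey6 1 (repW6 c))

/-- On an entry range: there are at least `b` children and the children `a ≤ t < b` of class `c` (whole subtrees) die. -/
def piecesOK6 (c a b : ℕ) : Option (ℕ × ℕ) → Bool
  | none => false
  | some (s, e) => decide (b ≤ e - s) && (List.range (b - a)).all fun i => srch6 20 2 (state2_6 c (ent6 1 (s + (a + i))))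

/-- On an entry range: the children `t ≥ a` of class `c` die. -/
def tailOK6 (c a : ℕ) : Option (ℕ × ℕ) → Bool
  | none => false
  | some (s, e) => (List.range (e - s - a)).all fun i => srch6 20 2 (state2_6 c (ent6 1 (s + (a + i))))

/-- On an entry range: all children of class `c` die (the two arms of the landed `searchT6`). -/
def fullOK6 (c : ℕ) : Option (ℕ × ℕ) → Bool
  | none => false
  | some (s, e) => (List.range (e - s)).all fun t => srch6 20 2 (state2_6 c (ent6 1 (s + t)))

/-- **CHECK B piece for class `c`:** its level-1 need key is a table key with at least `b` listed children, and the children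
`a ≤ t < b` die. -/
def searchT6p (c a b : ℕ) : Bool := piecesOK6 c a b (range1_6 c)

/-- **CHECK B tail for class `c`:** its level-1 need key is a table key and the listed children `t ≥ a` die. -/
def searchT6f (c a : ℕ) : Bool := tailOK6 c a (range1_6 c)

/-- **CHECK B (table part) for class `c`** — the replay's form of `searchT6 c = true`. -/
def SearchT6 (c : ℕ) : Prop := fullOK6 c (range1_6 c) = true

/-- `SearchT6 c` is decided by evaluating the Boolean check (used by `decide` on batches of small classes). -/
instance instDecidableSearchT6 (c : ℕ) : Decidable (SearchT6 c) := inferInstanceAs (Decidable (fullOK6 c (range1_6 c) = true))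

/-- Two adjacent pieces make a piece (abstract range). -/
theorem piecesOK6_append {c a m b : ℕ} (r : Option (ℕ × ℕ)) (ham : a ≤ m) (h1 : piecesOK6 c a m r = true)
    (h2 : piecesOK6 c m b r = true) : piecesOK6 c a b r = true := by
  rcases r with _ | ⟨s, e⟩
  · exact absurd h1 Bool.false_ne_true
  · simp only [piecesOK6, Bool.and_eq_true, decide_eq_true_eq, List.all_eq_true, List.mem_range] at h1 h2 ⊢
    refine ⟨h2.1, fun i hi => ?_⟩
    by_cases him : a + i < m
    · exact h1.2 i (by omega)
    · have h3 := h2.2 (a + i - m) (by omega)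
      rwa [show m + (a + i - m) = a + i by omega] at h3

/-- A piece from `0` and the tail give the full check (abstract range). -/
theorem fullOK6_of_pf {c m : ℕ} (r : Option (ℕ × ℕ)) (h1 : piecesOK6 c 0 m r = true) (h2 : tailOK6 c m r = true) :
    fullOK6 c r = true := by
  rcases r with _ | ⟨s, e⟩
  · exact absurd h1 Bool.false_ne_true
  · simp only [piecesOK6, tailOK6, fullOK6, Bool.and_eq_true, List.all_eq_true, List.mem_range, Nat.zero_add] at h1 h2 ⊢
    intro t ht
    by_cases htm : t < m
    · exact h1.2 t htm
    · have h3 := h2 (t - m) (by omega)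
      rwa [show m + (t - m) = t by omega] at h3

/-- **Two adjacent pieces make a piece.** -/
theorem searchT6p_append {c a m b : ℕ} (ham : a ≤ m) (h1 : searchT6p c a m = true) (h2 : searchT6p c m b = true) :
    searchT6p c a b = true :=
  piecesOK6_append (range1_6 c) ham h1 h2

/-- **A piece from `0` and the tail give `SearchT6 c`.** -/
theorem searchT6_of_pf {c m : ℕ} (h1 : searchT6p c 0 m = true) (h2 : searchT6f c m = true) : SearchT6 c :=
  fullOK6_of_pf (range1_6 c) h1 h2

/-! ## The MAIN CHECK in pieces -/

/-- **MAIN CHECK piece:** lanes `c₀ … c₀ + n − 1` of the total plane of element `h` pass (binary splitting as in `mainOK6`). -/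
def mainOK6p (h c₀ n : ℕ) : Bool := lanes6 13 c₀ n ((totPlane6 h >>> (588 * c₀)) % 2 ^ (588 * n))

/-- Lanes `a ≤ i < b` of the total plane of element `h` pass `laneOK6`. -/
def LanesOK6 (h a b : ℕ) : Prop := ∀ i, a ≤ i → i < b → laneOK6 i ((totPlane6 h >>> (588 * i)) % 2 ^ 588) = true

/-- Reading a lane below a cut: `((K mod 2^B) >>> A) mod 2^588 = (K >>> A) mod 2^588` when `A + 588 ≤ B`. -/
theorem lane_of_mod {K A B : ℕ} (h : A + 588 ≤ B) : (K % 2 ^ B) >>> A % 2 ^ 588 = K >>> A % 2 ^ 588 := by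
  apply Nat.eq_of_testBit_eq
  intro j
  simp only [Nat.testBit_mod_two_pow, Nat.testBit_shiftRight]
  by_cases hj : j < 588
  · simp [hj, show A + j < B by omega]
  · simp [hj]

/-- **Unfolding `lanes6` on a raw plane value:** if the binary-splitting check passes, every lane passes `laneOK6`. -/
theorem lanes6_lanes : ∀ fuel c n K, lanes6 fuel c n K = true → ∀ i < n, laneOK6 (c + i) (K >>> (588 * i) % 2 ^ 588) = true := by
  intro fuel
  induction fuel with
  | zero => intro c n K hl; simp [lanes6] at hl
  | succ fuel ih =>
    intro c n K hl i hi
    unfold lanes6 at hl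
    by_cases hn0 : n = 0
    · omega
    rw [if_neg hn0] at hl
    by_cases hn1 : n = 1
    · rw [if_pos hn1] at hl
      subst hn1
      have hi0 : i = 0 := by omega
      subst hi0
      rw [Nat.add_zero, Nat.mul_zero, Nat.shiftRight_zero]; exact hl
    rw [if_neg hn1, Bool.and_eq_true] at hl
    obtain ⟨h1, h2⟩ := hl
    by_cases hlow : i < n / 2
    · have h3 := ih c (n / 2) _ h1 i hlow
      rwa [Nat.and_two_pow_sub_one_eq_mod, lane_of_mod (by omega)] at h3
    · have h3 := ih (c + n / 2) (n - n / 2) _ h2 (i - n / 2) (by omega)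
      rwa [show c + n / 2 + (i - n / 2) = c + i by omega, ← Nat.shiftRight_add,
        show 588 * (n / 2) + 588 * (i - n / 2) = 588 * i by omega] at h3

/-- **A MAIN CHECK piece certifies its lanes.** -/
theorem lanesOK6_of_piece {h a n : ℕ} (hp : mainOK6p h a n = true) : LanesOK6 h a (a + n) := by
  intro i hai hib
  have h3 := lanes6_lanes 13 a n _ hp (i - a) (by omega)
  rwa [show a + (i - a) = i by omega, lane_of_mod (by omega), ← Nat.shiftRight_add,
    show 588 * a + 588 * (i - a) = 588 * i by omega] at h3

/-- Adjacent lane ranges. -/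
theorem lanesOK6_append {h a m b : ℕ} (h1 : LanesOK6 h a m) (h2 : LanesOK6 h m b) : LanesOK6 h a b :=
  fun i hai hib => if him : i < m then h1 i hai him else h2 i (by omega) hib

/-- The unsplit main check certifies all lanes (not used by the replay; recorded for comparison with `mainOK6`). -/
theorem lanesOK6_of_mainOK6 {h : ℕ} (hM : mainOK6 h = true) : LanesOK6 h 0 3692 := by
  intro i _ hib
  have h3 := lanes6_lanes 13 0 3692 _ hM i hib
  rwa [Nat.zero_add] at h3

end Summit.MatrixMultiplication.OmegaCensus.SmallFormats
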